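import Summits.CriticalPhenomena.PercolationContinuityZ3.Theorems.PercNearOneGluingNoHeavyLowerTailSahiCTCLadderThreeRowOneDense
import Summits.CriticalPhenomena.PercolationContinuityZ3.Theorems.PercNearOneGluingNoHeavyLowerTailSahiCTCKleitmanPinnedT
import HarnessLib

/-!
# `NoHeavyLowerTail` (crux stmt-CriticalPhenomena-4575), P3 lane: the row `#dbl = 1` of `(L_3)` — all regimes

Support file (seat `prim-l12-p3`, gen 26; `--supports stmt-CriticalPhenomena-4575`).  Memo g26 §4.11–4.13.  For a profile
`m = 2·1_d + 1_T` (`#dbl m = 1`, `τ = #T ≥ 7`) the restriction cubes `κ(∅, d ∪ T∖Q)` are bounded by the PINNED 3-density at `d`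
(`pinnedT_le_kap`): `κ ≥ cH(3,τ−2)/C(τ−2,2) · #{d-pairs inside} + (τ−1)/C(τ−2,3) · #{triples inside}`, the link cubes `κ({d}, T∖E)`
by 2-DENSITY; summed, the supply exceeds the charge by `(τ²−7τ+7)((τ−2)g − 3ε)/(3(τ−2))`, which is `≥ 0` exactly in the SPARSE
regime `3ε ≤ (τ−2)g` (`coeff_ladder_three_rowOne_nonneg_of_sparse`); the dense regime is `coeff_ladder_three_rowOne_nonneg_of_dense`.
Together: **`coeff_ladder_three_rowOne_nonneg`** — ROW `#dbl = 1` OF `(L_3)` for `τ ≥ 7`, unconditionally.  Nothing is asserted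
about the crux.
-/

namespace Summit.CriticalPhenomena.PercolationContinuityZ3.Theorems.SahiCTCForms

open Finset MvPolynomial SahiCTCGenFun SahiCTCWeightedLYM

variable {α : Type*} [DecidableEq α] [Fintype α]

section RowOneAll
variable {𝒳 𝒵 : Finset (Finset α)}

omit [DecidableEq α] [Fintype α] in
/-- The integer arithmetic of the sparse regime (certificate `(n² − 3n − 3)(n g − 3ε) ≥ 0`, `n = τ − 2`). [this work] -/
theorem rowOne_sparse_arith {nz Cc R g ε gW eW Γ c2 c2' c3 cH3 : ℤ} (hnz5 : 5 ≤ nz)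
    (sP : c2 * (cH3 * c3 * g + (nz + 1) * c2' * ε) ≤ c2 * (c3 * R)) (sC : nz * (g * c3) ≤ c2' * Cc)
    (e2 : c2 * 2 = nz * (nz - 1)) (e2' : c2' * 2 = (nz - 1) * (nz - 2)) (e3 : c3 * 3 = c2' * nz)
    (ecH3 : 2 * cH3 = nz ^ 2 + nz + 2) (ecH3' : 2 * Γ = (nz + 1) ^ 2 + (nz + 1) + 2) (hg' : gW ≤ g) (hε' : eW ≤ ε)
    (hsparse : 3 * ε ≤ nz * g) : Γ * gW + nz * eW ≤ R + Cc := by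
  have hnzpos : (0 : ℤ) < nz := by linarith
  have hc2pos : 0 < c2 := by
    have h : (0 : ℤ) < nz * (nz - 1) := mul_pos (by linarith) (by linarith)
    linarith [e2]
  have hc2'pos : 0 < c2' := by
    have h : (0 : ℤ) < (nz - 1) * (nz - 2) := mul_pos (by linarith) (by linarith)
    linarith [e2']
  have hc3pos : 0 < c3 := by
    have h : (0 : ℤ) < c2' * nz := mul_pos hc2'pos hnzpos
    linarith [e3]
  have h1 : cH3 * c3 * g + (nz + 1) * c2' * ε ≤ c3 * R := le_of_mul_le_mul_left sP hc2pos
  have h2 : nz * (cH3 * g) + 3 * (nz + 1) * ε ≤ nz * R := by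
    have h := mul_le_mul_of_nonneg_left h1 hnzpos.le
    have eq1 : c3 * (nz * (cH3 * g) + 3 * (nz + 1) * ε) = nz * (cH3 * c3 * g + (nz + 1) * c2' * ε) := by
      linear_combination ((nz + 1) * ε) * e3
    have eq2 : nz * (c3 * R) = c3 * (nz * R) := by ring
    rw [← eq1, eq2] at h
    exact le_of_mul_le_mul_left h hc3pos
  have h3 : nz ^ 2 * g ≤ 3 * Cc := by
    have h4 : 3 * (nz * (g * c3)) ≤ 3 * (c2' * Cc) := by linarith [sC]
    have eq1 : 3 * (nz * (g * c3)) = c2' * (nz ^ 2 * g) := by linear_combination (nz * g) * e3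
    have eq2 : 3 * (c2' * Cc) = c2' * (3 * Cc) := by ring
    rw [eq1, eq2] at h4
    exact le_of_mul_le_mul_left h4 hc2'pos
  have hΓ : Γ = cH3 + nz + 1 := by nlinarith [ecH3, ecH3']
  have hΓ0 : 0 ≤ Γ := by nlinarith [ecH3']
  have hprod : 0 ≤ (nz ^ 2 - 3 * nz - 3) * (nz * g - 3 * ε) := mul_nonneg (by nlinarith) (by linarith)
  have key : 3 * nz * (Γ * g + nz * ε) ≤ 3 * nz * (R + Cc) := by
    have h3' := mul_le_mul_of_nonneg_left h3 hnzpos.le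
    rw [hΓ]
    nlinarith [h2, h3', hprod]
  have key' := le_of_mul_le_mul_left key (by linarith : (0 : ℤ) < 3 * nz)
  nlinarith [key', mul_le_mul_of_nonneg_left hg' hΓ0, mul_le_mul_of_nonneg_left hε' hnzpos.le]

/-- **Row `#dbl = 1` of `(L_3)` in the sparse regime**: if `3·ε ≤ (τ−2)·g` and `τ ≥ 7` then `[m] L_3 ≥ 0` — PINNED 3-density at `d`
on the restriction cubes, 2-DENSITY on the link cubes. [this work] -/
theorem coeff_ladder_three_rowOne_nonneg_of_sparse (h𝒳 : IsUpperSet (𝒳 : Set (Finset α))) (h𝒵 : IsUpperSet (𝒵 : Set (Finset α)))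
    (hX3 : ∀ S ∈ 𝒳, 3 ≤ #S) (hZ3 : ∀ S ∈ 𝒵, 3 ≤ #S) {m : α →₀ ℕ} (hm : ∀ i, m i ≤ 2) (hD : #(dbl m) = 1) {d : α} (hd : d ∈ dbl m)
    (hτ : 7 ≤ #(lev m 1))
    (hsparse : 3 * #(((lev m 1).powersetCard 3).filter fun E => E ∈ 𝒳 ∧ E ∈ 𝒵) ≤
      (#(lev m 1) - 2) * #(((lev m 1).powersetCard 2).filter fun Q => insert d Q ∈ 𝒳 ∧ insert d Q ∈ 𝒵)) :
    0 ≤ (ee 3 * (PiP * gf (𝒳 ∩ 𝒵) - gf 𝒳 * gf 𝒵) -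
      gf (bySize (· ≤ 3 - 1) : Finset (Finset α)) * gf (bySize (3 ≤ ·) : Finset (Finset α)) *
        gf ((𝒳 ∩ 𝒵).filter fun S => #S = 3)).coeff m := by
  set W := (𝒳 ∩ 𝒵).filter fun S => #S = 3 with hWdef
  have hW3 : ∀ w ∈ W, #w = 3 := fun w hw => (mem_filter.1 hw).2
  have hWsub : ∀ w ∈ W, w ∈ 𝒳 ∧ w ∈ 𝒵 := fun w hw => mem_inter.1 (mem_filter.1 hw).1
  have hdT : d ∉ lev m 1 := fun h => disjoint_left.1 (disjoint_dbl_lev_one m) hd h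
  set GT := ((lev m 1).powersetCard 2).filter fun Q => insert d Q ∈ 𝒳 ∧ insert d Q ∈ 𝒵 with hGT
  set ET := ((lev m 1).powersetCard 3).filter fun E => E ∈ 𝒳 ∧ E ∈ 𝒵 with hET
  rw [coeff_sub, sub_nonneg]
  refine (coeff_chargeT_rowOne_le hm hD hd (by omega) W hW3).trans (le_trans ?_ (cubes_le_coeff_ee_mul_harris_rowOne h𝒳 h𝒵 hm hD hd))
  have hg : #(((lev m 1).powersetCard 2).filter fun Q => insert d Q ∈ W) ≤ #GT :=
    card_le_card fun Q hQ => mem_filter.2 ⟨(mem_filter.1 hQ).1, hWsub _ (mem_filter.1 hQ).2⟩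
  have hε : #(((lev m 1).powersetCard 3).filter fun E => E ∈ W) ≤ #ET :=
    card_le_card fun E hE => mem_filter.2 ⟨(mem_filter.1 hE).1, hWsub _ (mem_filter.1 hE).2⟩
  -- liveness of the traces
  have hl3X : ∀ s, ∀ U ∈ tr 𝒳 ∅ s, 3 ≤ #U := fun s U hU => hX3 U (by simpa using (mem_tr.1 hU).2)
  have hl3Z : ∀ s, ∀ U ∈ tr 𝒵 ∅ s, 3 ≤ #U := fun s U hU => hZ3 U (by simpa using (mem_tr.1 hU).2)
  have hl2X : ∀ s, ∀ U ∈ tr 𝒳 {d} s, 2 ≤ #U := fun s U hU => by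
    have := hX3 _ (mem_tr.1 hU).2; have := card_union_le ({d} : Finset α) U; rw [card_singleton] at this; omega
  have hl2Z : ∀ s, ∀ U ∈ tr 𝒵 {d} s, 2 ≤ #U := fun s U hU => by
    have := hZ3 _ (mem_tr.1 hU).2; have := card_union_le ({d} : Finset α) U; rw [card_singleton] at this; omega
  have hcs2 : ∀ s, s ⊆ lev m 1 → csetsT 𝒳 𝒵 {d} s 2 = GT.filter fun w => w ⊆ s := fun s hs => by
    ext w; simp only [csetsT, GT, mem_filter, mem_powersetCard, insert_eq]
    constructor
    · rintro ⟨⟨hws, hw2⟩, hX, hZ⟩; exact ⟨⟨⟨hws.trans hs, hw2⟩, hX, hZ⟩, hws⟩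
    · rintro ⟨⟨⟨_, hw2⟩, hX, hZ⟩, hws⟩; exact ⟨⟨hws, hw2⟩, hX, hZ⟩
  -- pinned and unpinned common triples of a restriction cube
  have hpin : ∀ s, s ⊆ lev m 1 → #(GT.filter fun w => w ⊆ s) ≤ #((csetsT 𝒳 𝒵 ∅ (insert d s) 3).filter fun w => d ∈ w) :=
      fun s hs => by
    refine card_le_card_of_injOn (fun Q => insert d Q) (fun Q hQ => ?_) (fun Q hQ Q' hQ' h => ?_)
    · obtain ⟨hQG, hQs⟩ := mem_filter.1 (Finset.mem_coe.1 hQ)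
      obtain ⟨hQ2, hX, hZ⟩ := mem_filter.1 hQG
      obtain ⟨hQT, hQc⟩ := mem_powersetCard.1 hQ2
      refine Finset.mem_coe.2 (mem_filter.2 ⟨mem_csetsT.2 ⟨insert_subset_insert d hQs, ?_, ?_, ?_⟩, mem_insert_self d Q⟩)
      · rw [card_insert_of_notMem (fun h => hdT (hQT h)), hQc]
      · rw [empty_union]; exact hX
      · rw [empty_union]; exact hZ
    · have hQT := (mem_powersetCard.1 (mem_filter.1 (mem_filter.1 (Finset.mem_coe.1 hQ)).1).1).1
      have hQT' := (mem_powersetCard.1 (mem_filter.1 (mem_filter.1 (Finset.mem_coe.1 hQ')).1).1).1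
      have h' : insert d Q = insert d Q' := h
      rw [← erase_insert (fun h => hdT (hQT h)), h', erase_insert (fun h => hdT (hQT' h))]
  have hunp : ∀ s, s ⊆ lev m 1 → #(ET.filter fun w => w ⊆ s) ≤ #((csetsT 𝒳 𝒵 ∅ (insert d s) 3).filter fun w => d ∉ w) :=
      fun s hs => by
    refine card_le_card fun E hE => ?_
    obtain ⟨hEE, hEs⟩ := mem_filter.1 hE
    obtain ⟨hE3, hX, hZ⟩ := mem_filter.1 hEE
    obtain ⟨hET', hEc⟩ := mem_powersetCard.1 hE3
    refine mem_filter.2 ⟨mem_csetsT.2 ⟨hEs.trans (subset_insert d s), hEc, ?_, ?_⟩, fun h => hdT (hET' h)⟩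
    · rw [empty_union]; exact hX
    · rw [empty_union]; exact hZ
  obtain ⟨n, hn⟩ : ∃ n : ℕ, #(lev m 1) = n + 2 := ⟨#(lev m 1) - 2, by omega⟩
  have hn5 : 5 ≤ n := by omega
  have hnT : ∀ Q ∈ (lev m 1).powersetCard 2, #(lev m 1 \ Q) = n := fun Q hQ => by
    rw [card_sdiff_of_subset (mem_powersetCard.1 hQ).1, (mem_powersetCard.1 hQ).2]; omega
  have hnE : ∀ E ∈ (lev m 1).powersetCard 3, #(lev m 1 \ E) = n - 1 := fun E hE => by
    rw [card_sdiff_of_subset (mem_powersetCard.1 hE).1, (mem_powersetCard.1 hE).2]; omega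
  have hcH2 : ∀ k, 3 ≤ k → cH 2 k = k + 1 := fun k hk => by
    unfold cH; rw [show min 2 (k + 1 - 2) = 2 from by omega]; simp [sum_range_succ]; omega
  -- (p) the restriction cubes by PINNED 3-density at d, (c) the link E-cubes by 2-DENSITY
  have hp : ∀ Q ∈ (lev m 1).powersetCard 2,
      ((cH 3 n * n.choose 3 : ℕ) : ℤ) * #(GT.filter fun w => w ⊆ lev m 1 \ Q)
        + ((cH 2 n * n.choose 2 : ℕ) : ℤ) * #(ET.filter fun w => w ⊆ lev m 1 \ Q)
        ≤ ((n.choose 2 * n.choose 3 : ℕ) : ℤ) * kap 𝒳 𝒵 ∅ (insert d (lev m 1 \ Q)) := fun Q hQ => by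
    have hds : d ∉ lev m 1 \ Q := fun h => hdT (mem_sdiff.1 h).1
    have h := pinnedT_le_kap h𝒳 h𝒵 2 n ∅ (insert d (lev m 1 \ Q)) d (disjoint_empty_left _)
      (by rw [card_insert_of_notMem hds, hnT Q hQ]) (mem_insert_self d _) (by omega) (hl3X _) (hl3Z _)
    have h1 := hpin (lev m 1 \ Q) sdiff_subset
    have h2 := hunp (lev m 1 \ Q) sdiff_subset
    have m1 := mul_le_mul_of_nonneg_left (show (#(GT.filter fun w => w ⊆ lev m 1 \ Q) : ℤ)
        ≤ #((csetsT 𝒳 𝒵 ∅ (insert d (lev m 1 \ Q)) 3).filter fun w => d ∈ w) by exact_mod_cast h1)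
      (show (0 : ℤ) ≤ ((cH 3 n * n.choose 3 : ℕ) : ℤ) from Nat.cast_nonneg _)
    have m2 := mul_le_mul_of_nonneg_left (show (#(ET.filter fun w => w ⊆ lev m 1 \ Q) : ℤ)
        ≤ #((csetsT 𝒳 𝒵 ∅ (insert d (lev m 1 \ Q)) 3).filter fun w => d ∉ w) by exact_mod_cast h2)
      (show (0 : ℤ) ≤ ((cH 2 n * n.choose 2 : ℕ) : ℤ) from Nat.cast_nonneg _)
    linarith
  have hc : ∀ E ∈ (lev m 1).powersetCard 3,
      (((n : ℕ) : ℤ)) * #(GT.filter fun w => w ⊆ lev m 1 \ E) ≤ ((n - 1).choose 2 : ℤ) * kap 𝒳 𝒵 {d} (lev m 1 \ E) := fun E hE => by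
    have h := densityT_le_kap h𝒳 h𝒵 2 (n - 1) {d} (lev m 1 \ E) (disjoint_singleton_left.2 fun h => hdT (mem_sdiff.1 h).1) (hnE E hE)
      (hl2X _) (hl2Z _)
    rw [hcs2 _ sdiff_subset, hcH2 (n - 1) (by omega), show n - 1 + 1 = n from by omega] at h; exact h
  -- double counting
  have hGT' : ∀ w ∈ GT, w ⊆ lev m 1 ∧ #w = 2 := fun w hw => mem_powersetCard.1 (mem_filter.1 hw).1
  have hET' : ∀ w ∈ ET, w ⊆ lev m 1 ∧ #w = 3 := fun w hw => mem_powersetCard.1 (mem_filter.1 hw).1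
  have sP := sum_le_sum hp
  have sC := sum_le_sum hc
  rw [sum_add_distrib, ← mul_sum, ← mul_sum, ← mul_sum] at sP
  rw [← mul_sum, ← mul_sum] at sC
  have dA : ∑ Q ∈ (lev m 1).powersetCard 2, (#(GT.filter fun w => w ⊆ lev m 1 \ Q) : ℤ) = #GT * (n.choose 2 : ℕ) := by
    have := sum_card_filter_subset_sdiff hGT' 2; rw [hn, show n + 2 - 2 = n from by omega] at this; exact_mod_cast this
  have dB : ∑ Q ∈ (lev m 1).powersetCard 2, (#(ET.filter fun w => w ⊆ lev m 1 \ Q) : ℤ) = #ET * ((n - 1).choose 2 : ℕ) := by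
    have := sum_card_filter_subset_sdiff hET' 2; rw [hn, show n + 2 - 3 = n - 1 from by omega] at this; exact_mod_cast this
  have dC : ∑ E ∈ (lev m 1).powersetCard 3, (#(GT.filter fun w => w ⊆ lev m 1 \ E) : ℤ) = #GT * (n.choose 3 : ℕ) := by
    have := sum_card_filter_subset_sdiff hGT' 3; rw [hn, show n + 2 - 2 = n from by omega] at this; exact_mod_cast this
  rw [dA, dB] at sP; rw [dC] at sC
  -- binomial identities
  have e2 : ((n.choose 2 : ℕ) : ℤ) * 2 = (n : ℤ) * (n - 1) := by
    have h2 : n.choose 2 * 2 = n * (n - 1) := by rw [Nat.choose_two_right]; exact Nat.div_mul_cancel (Nat.even_mul_pred_self n).two_dvd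
    have := congrArg (fun k : ℕ => (k : ℤ)) h2; push_cast [Nat.cast_sub (by omega : 1 ≤ n)] at this; linarith
  have e2' : (((n - 1).choose 2 : ℕ) : ℤ) * 2 = ((n : ℤ) - 1) * (n - 2) := by
    have h2 : (n - 1).choose 2 * 2 = (n - 1) * (n - 1 - 1) := by
      rw [Nat.choose_two_right]; exact Nat.div_mul_cancel (Nat.even_mul_pred_self _).two_dvd
    have := congrArg (fun k : ℕ => (k : ℤ)) h2
    push_cast [Nat.cast_sub (by omega : 1 ≤ n), Nat.cast_sub (by omega : 1 ≤ n - 1)] at this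
    nlinarith [this]
  have e3 : ((n.choose 3 : ℕ) : ℤ) * 3 = (((n - 1).choose 2 : ℕ) : ℤ) * n := by
    have h3 : n.choose 3 * 3 = (n - 1).choose 2 * n := by
      have := Nat.add_one_mul_choose_eq (n - 1) 2
      rw [show n - 1 + 1 = n from by omega] at this
      linarith
    exact_mod_cast h3
  have ecH3 : 2 * (cH 3 n : ℤ) = (n : ℤ) ^ 2 + n + 2 := two_mul_cH_three hn5
  have ecH3' : 2 * (cH 3 (#(lev m 1) - 1) : ℤ) = ((n : ℤ) + 1) ^ 2 + (n + 1) + 2 := by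
    rw [hn, show n + 2 - 1 = n + 1 from by omega]; have := two_mul_cH_three (n := n + 1) (by omega); push_cast at this; linarith
  have ecH2 : (cH 2 (#(lev m 1) - 3) : ℤ) = n := by
    rw [hn, show n + 2 - 3 = n - 1 from by omega, hcH2 (n - 1) (by omega)]; push_cast [Nat.cast_sub (by omega : 1 ≤ n)]; ring
  have hcH2n : cH 2 n = n + 1 := hcH2 n (by omega)
  rw [hcH2n] at sP
  have hg' : (#(((lev m 1).powersetCard 2).filter fun Q => insert d Q ∈ W) : ℤ) ≤ #GT := by exact_mod_cast hg
  have hε' : (#(((lev m 1).powersetCard 3).filter fun E => E ∈ W) : ℤ) ≤ #ET := by exact_mod_cast hε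
  have hsparse' : 3 * (#ET : ℤ) ≤ (n : ℤ) * #GT := by
    have := hsparse; rw [hn, show n + 2 - 2 = n from by omega] at this; exact_mod_cast this
  -- opaque names
  generalize hC : ∑ E ∈ (lev m 1).powersetCard 3, kap 𝒳 𝒵 {d} (lev m 1 \ E) = Cc at sC ⊢
  generalize hR : ∑ Q ∈ (lev m 1).powersetCard 2, kap 𝒳 𝒵 ∅ (insert d (lev m 1 \ Q)) = R at sP ⊢
  generalize hg₀ : (#GT : ℤ) = g at sP sC hg' hsparse'
  generalize hε₀ : (#ET : ℤ) = ε at sP hε' hsparse'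
  generalize hgW : (#(((lev m 1).powersetCard 2).filter fun Q => insert d Q ∈ W) : ℤ) = gW at hg' ⊢
  generalize hεW : (#(((lev m 1).powersetCard 3).filter fun E => E ∈ W) : ℤ) = eW at hε' ⊢
  generalize hΓ₀ : (cH 3 (#(lev m 1) - 1) : ℤ) = Γ at ecH3' ⊢
  rw [ecH2]
  push_cast at sP sC
  generalize hc2 : ((n.choose 2 : ℕ) : ℤ) = c2 at sP e2
  generalize hc2' : (((n - 1).choose 2 : ℕ) : ℤ) = c2' at sP sC e2' e3
  generalize hc3 : ((n.choose 3 : ℕ) : ℤ) = c3 at sP sC e3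
  generalize hcH : (cH 3 n : ℤ) = cH3 at sP ecH3
  generalize hnz : (n : ℤ) = nz at *
  have hnz5 : (5 : ℤ) ≤ nz := by rw [← hnz]; exact_mod_cast hn5
  have sP' : c2 * (cH3 * c3 * g + (nz + 1) * c2' * ε) ≤ c2 * (c3 * R) := by linarith
  have hfin := rowOne_sparse_arith hnz5 sP' sC e2 e2' e3 ecH3 ecH3' hg' hε' hsparse'
  linarith [hfin]

/-- **ROW `#dbl = 1` OF `(L_3)`** (`τ ≥ 7`, unconditional): the dense-triple regime by `coeff_ladder_three_rowOne_nonneg_of_dense`,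
the sparse one by `coeff_ladder_three_rowOne_nonneg_of_sparse` (PINNED 3-density). [this work] -/
theorem coeff_ladder_three_rowOne_nonneg (h𝒳 : IsUpperSet (𝒳 : Set (Finset α))) (h𝒵 : IsUpperSet (𝒵 : Set (Finset α)))
    (hX3 : ∀ S ∈ 𝒳, 3 ≤ #S) (hZ3 : ∀ S ∈ 𝒵, 3 ≤ #S) {m : α →₀ ℕ} (hm : ∀ i, m i ≤ 2) (hD : #(dbl m) = 1) (hτ : 7 ≤ #(lev m 1)) :
    0 ≤ (ee 3 * (PiP * gf (𝒳 ∩ 𝒵) - gf 𝒳 * gf 𝒵) -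
      gf (bySize (· ≤ 3 - 1) : Finset (Finset α)) * gf (bySize (3 ≤ ·) : Finset (Finset α)) *
        gf ((𝒳 ∩ 𝒵).filter fun S => #S = 3)).coeff m := by
  obtain ⟨d, hd⟩ : (dbl m).Nonempty := card_pos.1 (by omega)
  by_cases hdense : (#(lev m 1) - 2) * #(((lev m 1).powersetCard 2).filter fun Q => insert d Q ∈ 𝒳 ∧ insert d Q ∈ 𝒵) ≤
      3 * #(((lev m 1).powersetCard 3).filter fun E => E ∈ 𝒳 ∧ E ∈ 𝒵)
  · exact coeff_ladder_three_rowOne_nonneg_of_dense h𝒳 h𝒵 hX3 hZ3 hm hD hd hτ hdense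
  · exact coeff_ladder_three_rowOne_nonneg_of_sparse h𝒳 h𝒵 hX3 hZ3 hm hD hd hτ (by omega)

end RowOneAll

end Summit.CriticalPhenomena.PercolationContinuityZ3.Theorems.SahiCTCForms
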